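import Literature.MathematicalPhysics.QuantumFieldTheory.Balaban1983to89.B9Thm33G0DivRAtPins

/-!
# BalabanUVNodes ∕ N06 ([B9], `Dag.B9_main`) — ROWS 20–21's (3.44)-TYPE MEMBER `D*_U G₀ ∇*_{U,μ}` (`Thm33G0DivR.h44Ds`, W-c face `hdiv`) AT def-Y's MEMBERS OF RECORD,
# FROM THE G₀ LAYER'S `Thm33G0Dir` — the member-∀ knit of dag-n06-w5's `B9Thm33G0DivRAtPins.h44Ds_pins` with [4] (2.61) above ONE threshold

Track A of `YM-PLAN.md` (cell `pub-ymgap`, HUMAN RULING D-0062), node **N06** = [Balaban1985BackgroundPropagators] Thms 3.1–3.15; seat `pub-ymgap-dag-n06-d`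
(s2, «knit N06 at the ₁₁ record»), gen 12.  A HELPER for the stage-11 certificate editions ≥ 36.

WHAT.  Editions 16–35 display rows 20–21's W-c schema `hdiv : … → Thm33G0DivR (𝔬12 x) (𝔡A x).Dsd 1 (H x) _ (bHXA x) (bHX x) BiD BdD δ12₀ δ12₃ U` — BOTH (3.44)-type
members of [B9] Theorem 3.3 for `G₀ = G(U)` with the covariant divergence on the left (p. 398: *"we may always replace ∇_U by ∇\*_U, and vice versa, in arbitrary place
and combination"*).  The step engine of rows 20–21 READS ONLY THE FIRST (`h44Ds μ ε`: `D*_U G₀ ∇*_{U,μ}` out of the bond input Hölder class `bHK (bI x) ε` into the sup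
class `𝔠_W⁽⁰⁾`; see `Literature/…/B9Thm312WholeDirBCDs`, this seat, the engine twin with the hypothesis weakened to that field), and that field is dag-n06-w5's
THEOREM `h44Ds_pins` (p621802) of the rows-19-derived direction members `Thm33G0Dir` (the certificate's `(hG0C …).1`, DERIVED since edition 16 by
`N06G0LayerFromThm310AtPinsF.g0_layer_of_thm310_coreDir`, constants `B12₀ Bh12 Bi12 Bi2₁₂ δ12₀`, regime (M₀, a₀)) through the kinematic identity
`D*_U = Σ_ν J†_ν(U) ∘ ∇_{U,ν}` (`B9DivViaGradLettersAtPins`), the one-neighbour sup majorant of `J†_ν` (link variables of the (3.35) class contract) and [4] (2.61) —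
NO transport letter on `U`, NO rate inequality beyond `0 ≤ δ12₀`.  THIS FILE states the knit ONCE, in the member-∀ binder shape of this seat's layer
`N06StepDirLayerAtPinsBCZXDs.stepDirB_layer_of_lettersCZXDs` (input `hdivDs`):
★★ `hdivDs_of_pins` — inputs: the pins `hβ1` (block map 1-faithful), `hbHXA` (bond input Hölder family `bHK (bI x)`), `hblk12 ∕ hblkW12` (carrier block maps
`blkBK (bI x) ∕ blkSK (sIK (bI x))`), `hDvsco12` (`D*_U` = def-Y's coordinate model `DvscoKH`), `hDd` (`∇_{U,ν}` = the slice-constant model of `cdBₗ … ν`); the signs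
`hBi12`, `0 ≤ δ12₀`; the face `h33` as a ∀-family in the regime (M₀, a₀) under (3.35)∕(3.36).  Output: `∃ (MD : ℝ) (BiD : ℝ → ℝ), (∀ ε > 0, 0 ≤ BiD ε) ∧ ∀ x, MD ≤ M_x →
∀ α₀ > 0, M_xα₀ ≤ a₀ → ∀ U, Reg335 → Reg336 → ∀ μ ε, 0 < ε → HasMaj (bHXA x ε) (cNormR 1 (H x) (𝔬12 x).blkW _ 0) ((𝔬12 x).Dvstar U ∘ₗ ((𝔬12 x).G0 U ∘ₗ Dds x U μ))
(BiD ε·e^{−δ12₀d})`, with the CLOSED witnesses `MD := max M₀ M_L` ([4] (2.61) at rate 1, `rowSum261_geo9Y`) and `BiD ε := (d+1)·(cR39 (trBasis N)·e^{(δ12₀+1)·rJ}·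
Bi12 (min ε 1)·max c₁ 0)` (`ρ := δ12₀`, `σ := 1`, `δ_J := δ12₀ + 1`).
HONEST FRAMING.  Kernel bookkeeping (one application of dag-n06-w5's theorem per member, configuration, direction and exponent); COUNT-NEUTRAL; nothing of [B9]
asserted — the `Thm33G0Dir` family is the certificate's derived family, displayed here as a hypothesis; N06 NOT discharged.  One finite 𝕋⁴ programme at fixed `ε` — NOT
continuum, NOT OS, NOT the mass gap ∕ Clay.  0 `def`, 0 `sorry`.
-/

noncomputable section

namespace Summit.QuantumFields.YangMills.BalabanUVNodes.N06DivLegAtPinsPhys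

open Literature.MathematicalPhysics.QuantumFieldTheory.Balaban1983to89
open Literature.MathematicalPhysics.QuantumFieldTheory.Balaban1983to89.Node00 (FBondY IBondY)
open Literature.MathematicalPhysics.QuantumFieldTheory.Balaban1983to89.B9Thm34Ext (toB6)
open Literature.MathematicalPhysics.QuantumFieldTheory.Balaban1983to89.B11SectG (HasMaj BlockNorm RowSum)
open Literature.MathematicalPhysics.QuantumFieldTheory.Balaban1983to89.B9Thm312WholeClasses (cNormR)
open Literature.MathematicalPhysics.QuantumFieldTheory.Balaban1983to89.B9RWSums343Holder (HolderProbes)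
open Literature.MathematicalPhysics.QuantumFieldTheory.Balaban1983to89.B9Thm312WholeDir (Thm33G0Dir)
open Literature.MathematicalPhysics.QuantumFieldTheory.Balaban1983to89.B9CoReadingCoords (coordOpK XBK blkBK cdBₗ)
open Literature.MathematicalPhysics.QuantumFieldTheory.Balaban1983to89.B9CoReadingCoordsS (XSK blkSK sIK)
open Literature.MathematicalPhysics.QuantumFieldTheory.Balaban1983to89.B9CoReadingCoordsH (XHK)
open Literature.MathematicalPhysics.QuantumFieldTheory.Balaban1983to89.B9CoReadingCoordsInput (bHK)
open Literature.MathematicalPhysics.QuantumFieldTheory.Balaban1983to89.B9CoRealizesRelAtLetters (RelB)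
open Literature.MathematicalPhysics.QuantumFieldTheory.Balaban1983to89.B9CoReadingCoordsTranspose (TrIdx trBasis)
open Literature.MathematicalPhysics.QuantumFieldTheory.Balaban1983to89.B9Thm39ReadingCoords (cR39 cR39_nonneg)
open Literature.MathematicalPhysics.QuantumFieldTheory.Balaban1983to89.B9Thm33G0DivRAtPins (h44Ds_pins)
open Literature.MathematicalPhysics.QuantumFieldTheory.Balaban1983to89.B9PinMembersKLevelV1 (MemberY geo9Y bg9Y)
open Literature.MathematicalPhysics.QuantumFieldTheory.Balaban1983to89.B9GeoLemma21KLevelV1 (geo9Y_len_pos rowSum261_geo9Y)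
open Literature.MathematicalPhysics.QuantumFieldTheory.Balaban1983to89.B9GradViaDivLettersAtPins (rJ)
open Literature.MathematicalPhysics.QuantumFieldTheory.Balaban1983to89.Node00.OpsYSectDCoords (DvscoKH)
open Literature.MathematicalPhysics.QuantumFieldTheory.Balaban1983to89.B7Prop2SpecialUnitary (specialUnitaryUnits)
open Literature.MathematicalPhysics.QuantumFieldTheory.Balaban1983to89.B6GlobalChartV1 (blkV1)
open Literature.MathematicalPhysics.QuantumFieldTheory.Balaban1983to89.B6Ineq2142KLevelV1 (β)
open Literature.MathematicalPhysics.QuantumFieldTheory.Balaban1983to89.B6Geom246MultiLevelTorus (geomT)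
open scoped Matrix.Norms.L2Operator

variable {d ℓ : ℕ} {hd : 1 ≤ d + 1} {hL : Odd (ℓ + 1) ∧ 1 < ℓ + 1} {b₀ b₁ : ℝ} {Mstar : ℕ} {N : ℕ} [NeZero N]
variable [∀ x : MemberY d ℓ hd hL b₀ b₁ Mstar, Fintype (geo9Y x).Site] [∀ x : MemberY d ℓ hd hL b₀ b₁ Mstar, DecidableRel (RelB x.toKIdx)]

/-- ★★ **`hdiv.h44Ds` AT THE MEMBERS OF RECORD FROM THE G₀ LAYER'S `Thm33G0Dir`, ABOVE ONE THRESHOLD** (module docstring): the `hdivDs` input of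
`stepDirB_layer_of_lettersCZXDs` — `D*_U G₀ ∇*_{U,μ}` out of `bHK (bI x) ε` into `𝔠_W⁽⁰⁾` with `BiD ε·e^{−δ12₀d}`, every member above `MD`, every `U` of the (3.35)∕(3.36) class
in the regime (M₀, a₀), every direction `μ`, every `ε > 0` — with the closed witnesses `MD := max M₀ M_L` ([4] (2.61) at rate 1) and `BiD ε := (d+1)·(cR39 (trBasis N)·
e^{(δ12₀+1)·rJ}·Bi12 (min ε 1)·max c₁ 0)`, from dag-n06-w5's `h44Ds_pins` (`ρ := δ12₀`, `σ := 1`, `δ_J := δ12₀ + 1`) at the pins `hβ1 hbHXA hblk12 hblkW12 hDvsco12 hDd`.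
[cite: Balaban1985BackgroundPropagators, Thm 3.3 (3.44) p.398 + p.398 (remark after (3.47)) + (3.8) p.392 + (3.35) p.396 + Thm 3.12 pp.421–423; Balaban1984PropagatorsII, (2.51)–(2.56) pp.232–233 + Lemma 2.1 (2.61) p.234] -/
theorem hdivDs_of_pins {PX PY : MemberY d ℓ hd hL b₀ b₁ Mstar → Type} [∀ x, Fintype (PX x)] [∀ x, Fintype (PY x)]
    (H : MemberY d ℓ hd hL b₀ b₁ Mstar → Prop)
    (bI : ∀ x : MemberY d ℓ hd hL b₀ b₁ Mstar, FBondY x.toKIdx → IBondY x.toKIdx)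
    (hβ1 : ∀ (x : MemberY d ℓ hd hL b₀ b₁ Mstar) (f : FBondY x.toKIdx), (geomT x.D).dist (β x.hN x.D x.hk (bI x f)) (blkV1 x.hN x.D f) ≤ 1)
    (𝔭A : ∀ x : MemberY d ℓ hd hL b₀ b₁ Mstar, HolderProbes (geo9Y x) (bg9Y (Matrix (Fin N) (Fin N) ℂ) (specialUnitaryUnits (Fin N)) x) (XBK (TrIdx N) x.toKIdx)
      (XBK (TrIdx N) x.toKIdx) (PX x) (PY x))
    (Dd Dds : ∀ x : MemberY d ℓ hd hL b₀ b₁ Mstar, (bg9Y (Matrix (Fin N) (Fin N) ℂ) (specialUnitaryUnits (Fin N)) x).Cfg → Fin (d + 1) →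
      Module.End ℝ (XBK (TrIdx N) x.toKIdx → ℝ))
    (hDd : ∀ (x : MemberY d ℓ hd hL b₀ b₁ Mstar) (U : (bg9Y (Matrix (Fin N) (Fin N) ℂ) (specialUnitaryUnits (Fin N)) x).Cfg),
      Dd x U = fun μ => coordOpK (trBasis N) (fun _ : Fin (d + 1) => cdBₗ x.toKIdx U μ))
    (bHXA : ∀ x : MemberY d ℓ hd hL b₀ b₁ Mstar, ℝ → BlockNorm (toB6 (geo9Y x) 1 (H x)) ((XBK (TrIdx N) x.toKIdx) → ℝ))
    (hbHXA : ∀ x : MemberY d ℓ hd hL b₀ b₁ Mstar, bHXA x = fun ε =>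
      letI : Fintype (B9GeoNormsKLevelV1.geo9K x.toKIdx).Site := (inferInstance : Fintype (geo9Y x).Site); bHK x.toKIdx (bI x) ε)
    (𝔬12 : ∀ x : MemberY d ℓ hd hL b₀ b₁ Mstar, B9Thm312Whole.Ops (geo9Y x) (bg9Y (Matrix (Fin N) (Fin N) ℂ) (specialUnitaryUnits (Fin N)) x)
      (XBK (TrIdx N) x.toKIdx) (XBK (TrIdx N) x.toKIdx) (XHK (TrIdx N) x.toKIdx) (XSK (TrIdx N) x.toKIdx))
    (hblk12 : ∀ x : MemberY d ℓ hd hL b₀ b₁ Mstar, (𝔬12 x).blk = blkBK x.toKIdx (bI x))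
    (hblkW12 : ∀ x : MemberY d ℓ hd hL b₀ b₁ Mstar, (𝔬12 x).blkW = blkSK x.toKIdx (sIK x.toKIdx (bI x)))
    (hDvsco12 : ∀ (x : MemberY d ℓ hd hL b₀ b₁ Mstar) (U : (bg9Y (Matrix (Fin N) (Fin N) ℂ) (specialUnitaryUnits (Fin N)) x).Cfg),
      (𝔬12 x).Dvstar U = DvscoKH x.toKIdx (trBasis N) (bg9Y (Matrix (Fin N) (Fin N) ℂ) (specialUnitaryUnits (Fin N)) x) (fun U => U) U)
    {B12₀ δ12₀ M₀ a₀ c35 : ℝ} {Bh12 Bi12 : ℝ → ℝ} {Bi2₁₂ : ℝ → ℝ → ℝ}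
    (hBi12 : ∀ ε, 0 < ε → ε ≤ 1 → 0 ≤ Bi12 ε) (hδ12₀ : 0 ≤ δ12₀)
    (h33 : ∀ x : MemberY d ℓ hd hL b₀ b₁ Mstar, M₀ ≤ (geo9Y x).M → ∀ α₀ : ℝ, 0 < α₀ → (geo9Y x).M * α₀ ≤ a₀ →
      ∀ U : (bg9Y (Matrix (Fin N) (Fin N) ℂ) (specialUnitaryUnits (Fin N)) x).Cfg,
        (bg9Y (Matrix (Fin N) (Fin N) ℂ) (specialUnitaryUnits (Fin N)) x).Reg335 c35 α₀ U →
        (bg9Y (Matrix (Fin N) (Fin N) ℂ) (specialUnitaryUnits (Fin N)) x).Reg336 c35 α₀ U →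
          Thm33G0Dir (𝔬12 x) (𝔭A x) (Dd x) (Dds x) 1 (H x) (bHXA x) B12₀ Bh12 Bi12 Bi2₁₂ δ12₀ U) :
    ∃ (MD : ℝ) (BiD : ℝ → ℝ), (∀ ε, 0 < ε → 0 ≤ BiD ε) ∧
      ∀ x : MemberY d ℓ hd hL b₀ b₁ Mstar, MD ≤ (geo9Y x).M → ∀ α₀ : ℝ, 0 < α₀ → (geo9Y x).M * α₀ ≤ a₀ →
        ∀ U : (bg9Y (Matrix (Fin N) (Fin N) ℂ) (specialUnitaryUnits (Fin N)) x).Cfg,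
          (bg9Y (Matrix (Fin N) (Fin N) ℂ) (specialUnitaryUnits (Fin N)) x).Reg335 c35 α₀ U →
          (bg9Y (Matrix (Fin N) (Fin N) ℂ) (specialUnitaryUnits (Fin N)) x).Reg336 c35 α₀ U →
            ∀ (μ : Fin (d + 1)) (ε : ℝ), 0 < ε →
              HasMaj (bHXA x ε) (cNormR 1 (H x) (𝔬12 x).blkW (fun y => (geo9Y_len_pos x y).le) 0)
                ((𝔬12 x).Dvstar U ∘ₗ ((𝔬12 x).G0 U ∘ₗ Dds x U μ)) (fun a b => BiD ε * Real.exp (-(δ12₀ * (geo9Y x).dist a b))) := by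
  -- [4] (2.61) at rate 1 above ONE threshold, constant floored at 0
  obtain ⟨ML, c₁, hrow⟩ := rowSum261_geo9Y (d := d) (ℓ := ℓ) (hd := hd) (hL := hL) (b₀ := b₀) (b₁ := b₁) (Mstar := Mstar) 1 one_pos
  refine ⟨max M₀ ML, fun ε => (Fintype.card (Fin (d + 1)) : ℝ) * (cR39 (trBasis N) * Real.exp ((δ12₀ + 1) * rJ d ℓ) * Bi12 (min ε 1) * max c₁ 0),
    fun ε hε => mul_nonneg (Nat.cast_nonneg _) (mul_nonneg (mul_nonneg (mul_nonneg (cR39_nonneg _) (Real.exp_nonneg _))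
      (hBi12 (min ε 1) (lt_min hε one_pos) (min_le_right _ _))) (le_max_right _ _)), fun x hM α₀ hα ha U hU hU' μ ε hε => ?_⟩
  have hrowx : RowSum (toB6 (geo9Y x) 1 (H x)) 1 (max c₁ 0) := fun y => (hrow x ((le_max_right _ _).trans hM) y).trans (le_max_left _ _)
  exact h44Ds_pins x (hβ1 x) hU (hbHXA x) hrowx (le_max_right _ _) hBi12 hδ12₀ le_rfl (δJ := δ12₀ + 1) (by linarith only [hδ12₀]) (by linarith only)
    (hblk12 x) (hblkW12 x) (hDvsco12 x U) (hDd x U) (h33 x ((le_max_left _ _).trans hM) α₀ hα ha U hU hU') μ ε hε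

end Summit.QuantumFields.YangMills.BalabanUVNodes.N06DivLegAtPinsPhys

end
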